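import Summits.QuantumFields.YangMills.Theorems.BalabanUVNodesN18KernelLettersJunctionsUniform
import Summits.QuantumFields.YangMills.Theorems.BalabanUVNodesN18FiniteVolumeLettersModel
import Literature.MathematicalPhysics.QuantumFieldTheory.Balaban1983to89.Beta.LimitRate
import Literature.MathematicalPhysics.QuantumFieldTheory.Balaban1983to89.T4RateAlgebra

/-!
# BalabanUVNodes ∕ N18 — THE INDUCTIVE MECHANISM OF (5.10): the k-UNIFORM decay letters are CONSEQUENCES of node N18's STEP-RATE letter and the
# LEVEL-0 decay, by downward telescoping over the levels with shifted coupling histories (Track A, DAG node N18 = NE5 `T4OutputRate.NE5`; cluster K4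
# «SpineRates»; key K3⁷ `SpineGivenEndpointR13SepCoPH` = stmt-QuantumFields-20544, skeleton v5 941dddb108cbaacf; width seat `pub-ymgap-dag-n18-w4` g3,
# FILE 5 of the seat's kernel-currency lineage; `--kind proof --supports stmt-QuantumFields-20544 --as helper`, COUNT-NEUTRAL)

HONEST FRAMING.  Junction ∕ mechanism lemmas in HYPOTHESIS FORM.  The step-rate letter (node N18's input: W1-19b `WindowedStepRate` ∕ `KernelStepRate`,
Beta's `StepRate`, `T4RateAlgebra`'s (PR′)) and the LEVEL-0 decay row ARE the estimate and are asserted nowhere; [Balaban1987RG1] proves (5.10) p. 293 at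
EVERY step from (1.18) p. 263 («uniform in the lattice spacing»), not by the telescope below — what this file shows is that, in the tree's letter currency,
the k-UNIFORM (5.10) rows (W1-19c `WindowedDecayUniform`, W1-19 `DecayBound (EA …)`, `KernelDecay(OfRecord₁₃)`, Beta `UniformDecay`, `RatePair.decay`)
carry NO content beyond level `0` once the N18 letter is supplied: `|Π_0| ≤ E₀e^{−κ|z|₁}` and `|Π_{k+1} − Π_k| ≤ C′θ^k e^{−κ|z|₁}` with `0 ≤ θ < 1` give
`|Π_k| ≤ (E₀ + C′∕(1−θ)) e^{−κ|z|₁}` for every `k`.  Nothing of Bałaban's is asserted; N18 ∕ N17 ∕ (D4) NOT discharged; (5.10) NOT discharged; K3⁷ OPEN, not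
claimed; counts UNMOVED (typed 28∕28 · discharged 5∕28).  One finite four-torus programme at fixed `ε`, Bałaban AS PRINTED; R4 closes the conditional
finite-𝕋⁴ rung `BalabanLadder.UV` only — NOT ℝ⁴, NOT infinite volume, NOT OS, NOT a mass gap, NOT Clay; no summit statement is proved by this seat.
THEOREMS ONLY: 0 `def`, 0 `sorry`, standard axioms.

WHY.  Node N17's kernel road (dag-n17-a `scaleShiftRate_betaMerged_of_kernelStepRate`, Beta's `KernelInputs.ofStepRate`, `T4RateAlgebra.RatePair`) and the
(D4) read-out at the kernel objects of record (dag-n27-w1 `readOutAt_objectsOfRecord₁₃[_coPH]`, its `hdec := KernelDecayOfRecord₁₃ F N θ 0 1 ℓ.κ`) consume a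
k-UNIFORM (5.10) decay (UD) AND node N18's step rate (PR′) as TWO SEPARATE hypotheses; in K3⁷ v5's kernel-pinned bill (dag-n27-w1
`K3V5Defs.keyedRatesHolderD4_rrOfRecord_of_pins_of_letters`) they are the rows `hW : WindowedDecayOfRecord₁₃ … 0 1 κ` and `hS : WindowedStepRateOfRecord₁₃ … s κ θ₅
(C₅θ₅)`.  For HISTORY-DEPENDENT kernels `Π_{k+1}(g_0, …, g_k; z)` the step rate compares level `k + 1` at the history `(b, g_0, …, g_k)` with level `k` at
`(g_0, …, g_k)` ([I] Thm 1 p. 259: run B's unpaired first coupling `b`); telescoping DOWN to level `0` along `g ↦ (g_1, g_2, …)` (`Node00.prependCoupling (g 0)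
(g ∘ succ) = g`, `Fin.tail (histPrefix g (k+1)) = histPrefix (g ∘ succ) k`) stays inside the window `]0, γ]^ℕ`, so (UD) with the constant `E₀ + C′∕(1−θ)`
follows from (PR′) and the FIRST-STEP decay alone; at finite volume the per-level volume shift `K ↦ K + s` is absorbed by `Filter.eventually_atTop`.

WHAT.  §0 arithmetic (`sum_range_pow_succ_le`, `eventually_atTop_of_eventually_add`; partial geometric sums by Mathlib's `sum_le_hasSum`).  §1 SCALE-INDEXED kernels:
`abs_le_of_step_of_base` · `decay510_of_step_of_base` · ★ `uniformDecay_of_stepRate_of_base` (Beta: `StepRate P μ ν C′ δ θ` + `0 ≤ θ < 1` + `Decay510 (P 0 μ ν) C δ`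
⟹ `UniformDecay P μ ν (C + C′∕(1−θ)) δ` — the `hUD` of `KernelInputs.ofStepRate` from its own `hPR` + level 0) · `ratePair_of_rate_of_base` (`T4RateAlgebra` twin).
§2 LIMITING (1.21) KERNELS of ANY term family `ℰ`: `prependCoupling_head_tail` · `abs_kernelA_le_of_kernelStepRate_of_base` · ★ `decayBound_EA_of_kernelStepRate_of_base`
(W1-19b `KernelStepRate F ℰ ρ bV γ κ θ C₅`, `0 ≤ C₅`, `0 ≤ θ < 1`, level-0 (5.10) class on the window ⟹ W1-19's `DecayBound (EA F ℰ ρ bV) (Window γ) (E₀ + C₅·(θ∕(1−θ))) κ`)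
· `kernelDecay_of_kernelStepRate_of_base`.  §3 FINITE VOLUME (dag-n18-w2's `histPrefix_mem_box` BY NAME): `tail_histPrefix_succ` · `polWindow_eventually_le_of_windowedStepRate_of_base` · ★ `windowedDecayUniform_of_windowedStepRate_of_base`
(W1-19b `WindowedStepRate F ℰ ρ bV γ s κ θ C′`, `0 ≤ C′`, `0 ≤ θ < 1`, level-0 windowed decay eventually in `K` ⟹ W1-19c `WindowedDecayUniform F ℰ ρ bV (Window γ)
(E₀ + C′∕(1−θ)) κ`) · `windowedDecay_of_windowedStepRate_of_base`.  §4 JUNCTIONS BY NAME: `decayBound_EA_of_windowedStepRate_of_base` · `kernelDecay_of_windowedStepRate_of_base`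
· ★ `scaleShiftRate_betaMerged_of_windowedStepRate_of_base` (node N17's (J2) sentence from `PolLimitsExist` + `WindowedStepRate … s ℓ.κ ℓ.θ₅ (ℓ.C₅·ℓ.θ₅)` + the level-0
row under `ℓ.Signs`, `0 < ℓ.κ` — NO separate (UD) letter).  §5 AT THE RECORD: `windowedDecayUniformOfRecord₁₃_of_windowedStepRateOfRecord₁₃_of_base`
· ★ `kernelDecayOfRecord₁₃_of_windowedStepRateOfRecord₁₃_of_base` (the v5 bill's `hW`-CONSEQUENCE `KernelDecayOfRecord₁₃ F N θ μ ν κ` —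
dag-n27-w1's `hdec` at `(0,1)` — from `hL` + `hS` + the level-0 row) · `kernelDecayOfRecord₁₃_of_letters_of_base` · `kernelDecayOfRecord₁₃_of_kernelStepRateOfRecord₁₃_of_base`
· `scaleShiftRate_betaMergedOfRecord_of_windowedStepRateOfRecord₁₃_of_base` (node N17's sentence of record; dag-n18-w1's `…_of_finiteVolumeLetters` minus its `hU`).

Sources (TYPES and the mechanism only): T. Bałaban, Commun. Math. Phys. **109** (1987) 249–301 [Balaban1987RG1] — Thm 1 p. 259 (the window `]0, γ]`, «uniform in
the lattice spacing ε»), (1.18) p. 263 (inductive decay of the terms), (1.20)–(1.22) p. 264, (5.10) p. 293 (kernel decay); C. King, Commun. Math. Phys. **102** (1986)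
649–677 [King1986] — Lemma 4.5 (4.38) p. 674 (the printed one-step sibling of (PR′)).  No claim about the mass gap.
-/

noncomputable section

open Filter Topology
open scoped BigOperators

namespace YMDAG.N18.UniformDecayOfStepRate

open Literature.MathematicalPhysics.QuantumFieldTheory.Balaban1983to89
open Literature.MathematicalPhysics.QuantumFieldTheory.Balaban1983to89.T4Continuum (T4Family)
open Literature.MathematicalPhysics.QuantumFieldTheory.Balaban1983to89.T4OutputRate (Window DecayBound mem_window)
open Literature.MathematicalPhysics.QuantumFieldTheory.Balaban1983to89.T4CouplingMatching (ScaleShiftRate)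
open Literature.MathematicalPhysics.QuantumFieldTheory.Balaban1983to89.B12Sec2to5 (l1 l1_nonneg Decay510 betaPrime510)
open Literature.MathematicalPhysics.QuantumFieldTheory.Balaban1983to89.FlowStep (Box mem_box)
open Literature.MathematicalPhysics.QuantumFieldTheory.Balaban1983to89.Beta.LimitRate (StepRate UniformDecay subKernel_apply)
open Literature.MathematicalPhysics.QuantumFieldTheory.Balaban1983to89.T4RateAlgebra (RatePair step step_apply)
open Node00 (TermFamily1 polWindow PolLimitExists Stage13Params U3Letters₁₁ prependCoupling betaMerged mergedTermFamilyMatT TβOfRecord₁₃ chiβOfRecord₁₃)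
open Node00.U3OfKernels (histPrefix histPrefix_apply kernelA kernelA_congr EA decayBound_EA_iff KernelDecay KernelDecayOfRecord₁₃ kernelDecay_of_decayBound)
open Node00.U3KernelLetters (KernelStepRate WindowedStepRate WindowedDecay PolLimitsExist KernelStepRateOfRecord₁₃ WindowedStepRateOfRecord₁₃
  PolLimitsExistOfRecord₁₃)
open Node00.U3KernelLetters2 (WindowedDecayUniform WindowedDecayUniformOfRecord₁₃)
open YMDAG.N18.KernelLettersJunctions (decayBound_EA_of_windowedDecayUniform scaleShiftRate_betaMerged_of_kernelStepRate_of_windowedDecayUniform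
  scaleShiftRate_betaMergedOfRecord_of_uniformLetter)
open YMDAG.N18.AtRecordOfKernelLetters (kernelStepRate_of_windowed' kernelStepRateOfRecord₁₃_of_windowed')
open YMDAG.N22.AtKernels (kernelDecay_of_windowed)
open YMDAG.N18.FiniteVolumeLettersModel (histPrefix_mem_box)

/-! ## §0 Arithmetic: shifted partial geometric sums and an index shift in `Filter.atTop` -/

/-- Shifted partial geometric sums stay below `θ∕(1−θ)` for `0 ≤ θ < 1`. [folklore] -/
theorem sum_range_pow_succ_le {θ : ℝ} (h0 : 0 ≤ θ) (h1 : θ < 1) (k : ℕ) :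
    ∑ j ∈ Finset.range k, θ ^ (j + 1) ≤ θ / (1 - θ) := by
  have h : ∑ j ∈ Finset.range k, θ ^ (j + 1) = θ * ∑ j ∈ Finset.range k, θ ^ j := by
    rw [Finset.mul_sum]; exact Finset.sum_congr rfl fun j _ => by ring
  rw [h, div_eq_mul_inv]
  exact mul_le_mul_of_nonneg_left (sum_le_hasSum _ (fun j _ => pow_nonneg h0 j) (hasSum_geometric_of_lt_one h0 h1)) h0

/-- An `atTop`-eventual property of the shifted index `K + s` is an `atTop`-eventual property of `K`. [folklore] -/
theorem eventually_atTop_of_eventually_add (P : ℕ → Prop) (s : ℕ) (h : ∀ᶠ K in atTop, P (K + s)) : ∀ᶠ K in atTop, P K := by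
  obtain ⟨N, hN⟩ := eventually_atTop.1 h
  refine eventually_atTop.2 ⟨N + s, fun K hK => ?_⟩
  have h' := hN (K - s) (by omega); rwa [Nat.sub_add_cancel (by omega)] at h'

/-! ## §1 Scale-indexed kernels (no history): (UD) from (PR′) and the level-0 decay -/

section ScaleIndexed

variable {d : ℕ}

/-- **THE TELESCOPE, scale-indexed form**: one-step bounds `|X_{k+1}(x) − X_k(x)| ≤ C′θ^k e^{−δ|x|₁}` and a level-0 bound `|X_0(x)| ≤ C e^{−δ|x|₁}` give
`|X_k(x)| ≤ (C + C′ Σ_{j<k} θ^j) e^{−δ|x|₁}` at every level. [cite: Balaban1987RG1, (5.10) p.293 (mechanism; nothing of the source asserted)] -/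
theorem abs_le_of_step_of_base {X : ℕ → (Fin d → ℤ) → ℝ} {C C' δ θ : ℝ}
    (hstep : ∀ (k : ℕ) (x : Fin d → ℤ), |X (k + 1) x - X k x| ≤ C' * θ ^ k * Real.exp (-δ * l1 x))
    (h0 : ∀ x : Fin d → ℤ, |X 0 x| ≤ C * Real.exp (-δ * l1 x)) (k : ℕ) (x : Fin d → ℤ) :
    |X k x| ≤ (C + C' * ∑ j ∈ Finset.range k, θ ^ j) * Real.exp (-δ * l1 x) := by
  induction k with
  | zero => simpa using h0 x
  | succ k ih =>
    calc |X (k + 1) x| = |X k x + (X (k + 1) x - X k x)| := by congr 1; ring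
      _ ≤ |X k x| + |X (k + 1) x - X k x| := abs_add_le _ _
      _ ≤ (C + C' * ∑ j ∈ Finset.range k, θ ^ j) * Real.exp (-δ * l1 x) + C' * θ ^ k * Real.exp (-δ * l1 x) :=
        add_le_add ih (hstep k x)
      _ = (C + C' * ∑ j ∈ Finset.range (k + 1), θ ^ j) * Real.exp (-δ * l1 x) := by
        rw [Finset.sum_range_succ]; ring

/-- **(UD) FROM (PR′) + LEVEL 0, scale-indexed form**: with `0 ≤ θ < 1` and `0 ≤ C′` every level is in the (5.10) class with the ONE constant `C + C′∕(1−θ)`.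
[cite: Balaban1987RG1, (5.10) p.293 (mechanism; nothing of the source asserted)] -/
theorem decay510_of_step_of_base {X : ℕ → (Fin d → ℤ) → ℝ} {C C' δ θ : ℝ} (hθ0 : 0 ≤ θ) (hθ1 : θ < 1) (hC' : 0 ≤ C')
    (hstep : ∀ (k : ℕ) (x : Fin d → ℤ), |X (k + 1) x - X k x| ≤ C' * θ ^ k * Real.exp (-δ * l1 x))
    (h0 : ∀ x : Fin d → ℤ, |X 0 x| ≤ C * Real.exp (-δ * l1 x)) (k : ℕ) :
    Decay510 (X k) (C + C' / (1 - θ)) δ := fun x => by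
  refine (abs_le_of_step_of_base hstep h0 k x).trans (mul_le_mul_of_nonneg_right ?_ (Real.exp_pos _).le)
  rw [div_eq_mul_inv]
  exact add_le_add le_rfl (mul_le_mul_of_nonneg_left (sum_le_hasSum _ (fun j _ => pow_nonneg hθ0 j) (hasSum_geometric_of_lt_one hθ0 hθ1)) hC')

/-- ★ **Beta currency: `UniformDecay` FROM `StepRate` + THE LEVEL-0 DECAY.**  `StepRate P μ ν C′ δ θ` ((PR′), `Beta.LimitRate`), `0 ≤ θ < 1` and
`Decay510 (P 0 μ ν) C δ` give `UniformDecay P μ ν (C + C′∕(1−θ)) δ` — the `hUD` of `Beta.LimitRate.KernelInputs.ofStepRate` from its own `hPR` and level `0`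
(`0 ≤ C′` is `StepRate.const_nonneg`). [cite: Balaban1987RG1, (5.10) p.293 and (1.22) p.264 (mechanism; nothing of the source asserted)] -/
theorem uniformDecay_of_stepRate_of_base {P : ℕ → B12Beta.Kernel d} {μ ν : Fin d} {C C' δ θ : ℝ}
    (hS : StepRate P μ ν C' δ θ) (hθ0 : 0 ≤ θ) (hθ1 : θ < 1) (h0 : Decay510 (P 0 μ ν) C δ) :
    UniformDecay P μ ν (C + C' / (1 - θ)) δ := fun k =>
  decay510_of_step_of_base (X := fun k x => P k μ ν x) hθ0 hθ1 hS.const_nonneg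
    (fun k x => by simpa only [subKernel_apply] using hS k x) h0 k

/-- `T4RateAlgebra` currency: a `RatePair X (C + C′∕(1−θ)) δ C′ θ` FROM (PR′) ALONE + THE LEVEL-0 DECAY (`0 ≤ θ < 1`, `0 ≤ C′`).
[cite: King1986, Lemma 4.5 (4.38) p.674 (the printed one-step sibling; mechanism only)] -/
theorem ratePair_of_rate_of_base {X : ℕ → (Fin d → ℤ) → ℝ} {C C' δ θ : ℝ} (hθ0 : 0 ≤ θ) (hθ1 : θ < 1) (hC' : 0 ≤ C')
    (hrate : ∀ k, Decay510 (step X k) (C' * θ ^ k) δ) (h0 : Decay510 (X 0) C δ) :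
    RatePair X (C + C' / (1 - θ)) δ C' θ where
  decay := decay510_of_step_of_base hθ0 hθ1 hC' (fun k x => by simpa only [step_apply] using hrate k x) h0
  rate := hrate

end ScaleIndexed

/-! ## §2 Limiting (1.21) kernels of a term family: W1-19's decay slot from W1-19b's `KernelStepRate` and the level-0 decay -/

section Limiting

variable {𝔄 : Type*} [NormedRing 𝔄] [NormedAlgebra ℝ 𝔄]
variable {V : Type*} [NormedAddCommGroup V] [NormedSpace ℝ V] {ι : Type*} [Fintype ι]
variable (F : T4Family) (ℰ : TermFamily1 F 𝔄) (ρ : V →L[ℝ] 𝔄) (bV : Module.Basis ι ℝ V)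

/-- `(g_0, (g_1, g_2, …)) ↦ g`: a sequence is its first coupling prepended to its shift. [cite: Balaban1987RG1, Thm 1 p.259 (bookkeeping)] -/
theorem prependCoupling_head_tail (g : ℕ → ℝ) : prependCoupling (g 0) (fun i => g (i + 1)) = g := by
  funext i; cases i <;> rfl

variable {ℰ} in
/-- **THE TELESCOPE FOR HISTORY-DEPENDENT LIMITING KERNELS**: under W1-19b's `KernelStepRate F ℰ ρ bV γ κ θ C₅` and a level-0 (5.10) bound with constant `E₀`
on the window, `|Π_{k+1}(g_0, …, g_k; z)| ≤ (E₀ + C₅ Σ_{j<k} θ^{j+1}) e^{−κ|z|₁}` for every `g ∈ ]0, γ]^ℕ` — level `k` at `g` is compared with level `k − 1` at the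
SHIFTED history `(g_1, …)` (run B's first coupling `b := g_0`), down to level `0`. [cite: Balaban1987RG1, Thm 1 p.259 and (5.10) p.293 (mechanism; nothing of the source asserted)] -/
theorem abs_kernelA_le_of_kernelStepRate_of_base {γ κ θ C₅ E₀ : ℝ} (h18 : KernelStepRate F ℰ ρ bV γ κ θ C₅)
    (h0 : ∀ g ∈ Window γ, ∀ (μ ν : Fin 4), Decay510 (kernelA F ℰ ρ bV g 0 μ ν) E₀ κ)
    (k : ℕ) {g : ℕ → ℝ} (hg : g ∈ Window γ) (μ ν : Fin 4) (z : Fin 4 → ℤ) :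
    |kernelA F ℰ ρ bV g k μ ν z| ≤ (E₀ + C₅ * ∑ j ∈ Finset.range k, θ ^ (j + 1)) * Real.exp (-(κ * l1 z)) := by
  induction k generalizing g with
  | zero =>
    have h := h0 g hg μ ν z
    rw [neg_mul] at h; simpa using h
  | succ k ih =>
    have hb : 0 < g 0 ∧ g 0 ≤ γ := mem_window.1 hg 0
    have hg' : (fun i => g (i + 1)) ∈ Window γ := fun i => mem_window.1 hg (i + 1)
    have hstep := h18 (g 0) hb.1 hb.2 _ hg' k μ ν z
    rw [prependCoupling_head_tail] at hstep
    calc |kernelA F ℰ ρ bV g (k + 1) μ ν z|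
        = |kernelA F ℰ ρ bV (fun i => g (i + 1)) k μ ν z -
            (kernelA F ℰ ρ bV (fun i => g (i + 1)) k μ ν z - kernelA F ℰ ρ bV g (k + 1) μ ν z)| := by congr 1; ring
      _ ≤ |kernelA F ℰ ρ bV (fun i => g (i + 1)) k μ ν z| +
            |kernelA F ℰ ρ bV (fun i => g (i + 1)) k μ ν z - kernelA F ℰ ρ bV g (k + 1) μ ν z| := abs_sub _ _
      _ ≤ (E₀ + C₅ * ∑ j ∈ Finset.range k, θ ^ (j + 1)) * Real.exp (-(κ * l1 z)) + C₅ * θ ^ (k + 1) * Real.exp (-(κ * l1 z)) :=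
        add_le_add (ih hg') hstep
      _ = (E₀ + C₅ * ∑ j ∈ Finset.range (k + 1), θ ^ (j + 1)) * Real.exp (-(κ * l1 z)) := by
        rw [Finset.sum_range_succ]; ring

variable {ℰ} in
/-- ★ **W1-19's DECAY SLOT FROM W1-19b's STEP-RATE LETTER + THE LEVEL-0 DECAY**: `KernelStepRate F ℰ ρ bV γ κ θ C₅` (node N18's input at the kernel objects —
`NE5 (EA …) (EB … b)` for every member `b`), `0 ≤ C₅`, `0 ≤ θ < 1`, and the level-0 (5.10) class `Decay510 (kernelA … g 0 μ ν) E₀ κ` on the window give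
`DecayBound (EA F ℰ ρ bV) (Window γ) (E₀ + C₅·(θ∕(1−θ))) κ` — the k-UNIFORM constant for free. [cite: Balaban1987RG1, (1.18) p.263, Thm 1 p.259 and (5.10) p.293 (mechanism; nothing of the source asserted)] -/
theorem decayBound_EA_of_kernelStepRate_of_base {γ κ θ C₅ E₀ : ℝ} (hθ0 : 0 ≤ θ) (hθ1 : θ < 1) (hC₅ : 0 ≤ C₅)
    (h18 : KernelStepRate F ℰ ρ bV γ κ θ C₅) (h0 : ∀ g ∈ Window γ, ∀ (μ ν : Fin 4), Decay510 (kernelA F ℰ ρ bV g 0 μ ν) E₀ κ) :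
    DecayBound (EA F ℰ ρ bV) (Window γ) (E₀ + C₅ * (θ / (1 - θ))) κ :=
  (decayBound_EA_iff F ℰ ρ bV (Window γ) _ κ).2 fun g hg k μ ν z => by
    rw [neg_mul]
    refine (abs_kernelA_le_of_kernelStepRate_of_base F ρ bV h18 h0 k hg μ ν z).trans (mul_le_mul_of_nonneg_right ?_ (Real.exp_pos _).le)
    exact add_le_add le_rfl (mul_le_mul_of_nonneg_left (sum_range_pow_succ_le hθ0 hθ1 k) hC₅)

variable {ℰ} in
/-- W1-19's `KernelDecay` ((D4)'s `hdec` class) in EVERY direction pair from the step-rate letter + the level-0 decay. [cite: Balaban1987RG1, (5.10) p.293 (mechanism)] -/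
theorem kernelDecay_of_kernelStepRate_of_base {γ κ θ C₅ E₀ : ℝ} (hθ0 : 0 ≤ θ) (hθ1 : θ < 1) (hC₅ : 0 ≤ C₅)
    (h18 : KernelStepRate F ℰ ρ bV γ κ θ C₅) (h0 : ∀ g ∈ Window γ, ∀ (μ ν : Fin 4), Decay510 (kernelA F ℰ ρ bV g 0 μ ν) E₀ κ) (μ ν : Fin 4) :
    KernelDecay F ℰ ρ bV (Window γ) μ ν κ :=
  kernelDecay_of_decayBound F ℰ ρ bV (decayBound_EA_of_kernelStepRate_of_base F ρ bV hθ0 hθ1 hC₅ h18 h0) μ ν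

end Limiting

/-! ## §3 Finite volume: W1-19c's uniform windowed decay from W1-19b's `WindowedStepRate` and the level-0 windowed decay -/

section FiniteVolume

variable {𝔄 : Type*} [NormedRing 𝔄] [NormedAlgebra ℝ 𝔄]
variable {V : Type*} [NormedAddCommGroup V] [NormedSpace ℝ V] {ι : Type*} [Fintype ι]
variable (F : T4Family) (ℰ : TermFamily1 F 𝔄) (ρ : V →L[ℝ] 𝔄) (bV : Module.Basis ι ℝ V)

/-- The tail of the level-`(k+1)` prefix of `g` is the level-`k` prefix of the shifted sequence (`rfl`). [cite: Balaban1987RG1, §5 p.298 (bookkeeping)] -/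
theorem tail_histPrefix_succ (g : ℕ → ℝ) (k : ℕ) : Fin.tail (histPrefix g (k + 1)) = histPrefix (fun i => g (i + 1)) k := rfl

variable {ℰ} in
/-- **THE TELESCOPE AT FINITE VOLUME**: under W1-19b's `WindowedStepRate F ℰ ρ bV γ s κ θ C′` and a level-0 windowed bound with constant `E₀` (both EVENTUALLY in the
volume index `K`), `|Π^{(K)}_{k+1}(g_0, …, g_k; z)| ≤ (E₀ + C′ Σ_{j<k} θ^j) e^{−κ|z|₁}` eventually in `K`, for every `g ∈ ]0, γ]^ℕ` — the per-level volume shift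
`K ↦ K + s` of the two-run letter absorbed by `eventually_atTop_of_eventually_add`. [cite: Balaban1987RG1, Thm 1 p.259, (1.20) p.264 and (5.10) p.293 (mechanism; nothing of the source asserted)] -/
theorem polWindow_eventually_le_of_windowedStepRate_of_base {γ κ θ C' E₀ : ℝ} {s : ℕ} (hS : WindowedStepRate F ℰ ρ bV γ s κ θ C')
    (h0 : ∀ g ∈ Window γ, ∀ (μ ν : Fin 4) (z : Fin 4 → ℤ), ∀ᶠ K in atTop,
      |polWindow F K 1 (ℰ 0 (histPrefix g 0) K) ρ bV μ ν z| ≤ E₀ * Real.exp (-κ * l1 z))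
    (k : ℕ) {g : ℕ → ℝ} (hg : g ∈ Window γ) (μ ν : Fin 4) (z : Fin 4 → ℤ) :
    ∀ᶠ K in atTop, |polWindow F K (k + 1) (ℰ k (histPrefix g k) K) ρ bV μ ν z| ≤
      (E₀ + C' * ∑ j ∈ Finset.range k, θ ^ j) * Real.exp (-κ * l1 z) := by
  induction k generalizing g with
  | zero => simpa using h0 g hg μ ν z
  | succ k ih =>
    have hg' : (fun i => g (i + 1)) ∈ Window γ := fun i => mem_window.1 hg (i + 1)
    have hstep := hS k (histPrefix g (k + 1)) (histPrefix_mem_box hg (k + 1)) μ ν z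
    rw [tail_histPrefix_succ] at hstep
    refine eventually_atTop_of_eventually_add
      (fun K => |polWindow F K (k + 1 + 1) (ℰ (k + 1) (histPrefix g (k + 1)) K) ρ bV μ ν z| ≤
        (E₀ + C' * ∑ j ∈ Finset.range (k + 1), θ ^ j) * Real.exp (-κ * l1 z)) s ?_
    filter_upwards [hstep, ih hg'] with K hK hih
    calc |polWindow F (K + s) (k + 1 + 1) (ℰ (k + 1) (histPrefix g (k + 1)) (K + s)) ρ bV μ ν z|
        = |polWindow F K (k + 1) (ℰ k (histPrefix (fun i => g (i + 1)) k) K) ρ bV μ ν z +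
            (polWindow F (K + s) (k + 1 + 1) (ℰ (k + 1) (histPrefix g (k + 1)) (K + s)) ρ bV μ ν z -
              polWindow F K (k + 1) (ℰ k (histPrefix (fun i => g (i + 1)) k) K) ρ bV μ ν z)| := by congr 1; ring
      _ ≤ |polWindow F K (k + 1) (ℰ k (histPrefix (fun i => g (i + 1)) k) K) ρ bV μ ν z| +
            |polWindow F (K + s) (k + 1 + 1) (ℰ (k + 1) (histPrefix g (k + 1)) (K + s)) ρ bV μ ν z -
              polWindow F K (k + 1) (ℰ k (histPrefix (fun i => g (i + 1)) k) K) ρ bV μ ν z| := abs_add_le _ _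
      _ ≤ (E₀ + C' * ∑ j ∈ Finset.range k, θ ^ j) * Real.exp (-κ * l1 z) + C' * θ ^ k * Real.exp (-κ * l1 z) := add_le_add hih hK
      _ = (E₀ + C' * ∑ j ∈ Finset.range (k + 1), θ ^ j) * Real.exp (-κ * l1 z) := by
        rw [Finset.sum_range_succ]; ring

variable {ℰ} in
/-- ★ **W1-19c's `WindowedDecayUniform` FROM W1-19b's `WindowedStepRate` + THE LEVEL-0 WINDOWED DECAY**: with `0 ≤ C′`, `0 ≤ θ < 1`, ONE constant
`E₀ + C′∕(1−θ)` bounds the windowed kernels of EVERY level at EVERY sequence of the window, eventually in `K` — the uniform form node U3's decay slot and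
node N17's kernel road consume, with no (UD) letter supplied. [cite: Balaban1987RG1, Thm 1 p.259, (1.20) p.264 and (5.10) p.293 (mechanism; nothing of the source asserted)] -/
theorem windowedDecayUniform_of_windowedStepRate_of_base {γ κ θ C' E₀ : ℝ} {s : ℕ} (hθ0 : 0 ≤ θ) (hθ1 : θ < 1) (hC' : 0 ≤ C')
    (hS : WindowedStepRate F ℰ ρ bV γ s κ θ C')
    (h0 : ∀ g ∈ Window γ, ∀ (μ ν : Fin 4) (z : Fin 4 → ℤ), ∀ᶠ K in atTop,
      |polWindow F K 1 (ℰ 0 (histPrefix g 0) K) ρ bV μ ν z| ≤ E₀ * Real.exp (-κ * l1 z)) :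
    WindowedDecayUniform F ℰ ρ bV (Window γ) (E₀ + C' / (1 - θ)) κ := fun g hg k μ ν z => by
  filter_upwards [polWindow_eventually_le_of_windowedStepRate_of_base F ρ bV hS h0 k hg μ ν z] with K hK
  refine hK.trans (mul_le_mul_of_nonneg_right ?_ (Real.exp_pos _).le)
  rw [div_eq_mul_inv]
  exact add_le_add le_rfl (mul_le_mul_of_nonneg_left (sum_le_hasSum _ (fun j _ => pow_nonneg hθ0 j) (hasSum_geometric_of_lt_one hθ0 hθ1)) hC')

variable {ℰ} in
/-- W1-19b's per-sequence letter `WindowedDecay` in EVERY direction pair from `WindowedStepRate` + the level-0 windowed decay.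
[cite: Balaban1987RG1, (5.10) p.293 (mechanism)] -/
theorem windowedDecay_of_windowedStepRate_of_base {γ κ θ C' E₀ : ℝ} {s : ℕ} (hθ0 : 0 ≤ θ) (hθ1 : θ < 1) (hC' : 0 ≤ C')
    (hS : WindowedStepRate F ℰ ρ bV γ s κ θ C')
    (h0 : ∀ g ∈ Window γ, ∀ (μ ν : Fin 4) (z : Fin 4 → ℤ), ∀ᶠ K in atTop,
      |polWindow F K 1 (ℰ 0 (histPrefix g 0) K) ρ bV μ ν z| ≤ E₀ * Real.exp (-κ * l1 z)) (μ ν : Fin 4) :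
    WindowedDecay F ℰ ρ bV (Window γ) μ ν κ :=
  Node00.U3KernelLetters2.WindowedDecayUniform.windowedDecay F ρ bV (windowedDecayUniform_of_windowedStepRate_of_base F ρ bV hθ0 hθ1 hC' hS h0) μ ν

/-! ## §4 Junctions BY NAME: node U3's decay slot, W1-19's `KernelDecay` and node N17's (J2) sentence with NO separate (UD) letter -/

variable {ℰ} in
/-- **NODE U3's DECAY SLOT FROM `PolLimitsExist` + `WindowedStepRate` + THE LEVEL-0 ROW** (dag-n18-w1's `decayBound_EA_of_windowedDecayUniform` after §3).
[cite: Balaban1987RG1, (1.18) p.263, (1.21) p.264 and (5.10) p.293 (mechanism)] -/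
theorem decayBound_EA_of_windowedStepRate_of_base {γ κ θ C' E₀ : ℝ} {s : ℕ} (hθ0 : 0 ≤ θ) (hθ1 : θ < 1) (hC' : 0 ≤ C')
    (hlim : PolLimitsExist F ℰ ρ bV (Window γ)) (hS : WindowedStepRate F ℰ ρ bV γ s κ θ C')
    (h0 : ∀ g ∈ Window γ, ∀ (μ ν : Fin 4) (z : Fin 4 → ℤ), ∀ᶠ K in atTop,
      |polWindow F K 1 (ℰ 0 (histPrefix g 0) K) ρ bV μ ν z| ≤ E₀ * Real.exp (-κ * l1 z)) :
    DecayBound (EA F ℰ ρ bV) (Window γ) (E₀ + C' / (1 - θ)) κ :=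
  decayBound_EA_of_windowedDecayUniform F ℰ ρ bV hlim (windowedDecayUniform_of_windowedStepRate_of_base F ρ bV hθ0 hθ1 hC' hS h0)

variable {ℰ} in
/-- **W1-19's `KernelDecay` FROM `PolLimitsExist` + `WindowedStepRate` + THE LEVEL-0 ROW**, every direction pair (dag-n22-w3's `kernelDecay_of_windowed` after §3).
[cite: Balaban1987RG1, (1.21) p.264 and (5.10) p.293 (mechanism)] -/
theorem kernelDecay_of_windowedStepRate_of_base {γ κ θ C' E₀ : ℝ} {s : ℕ} (hθ0 : 0 ≤ θ) (hθ1 : θ < 1) (hC' : 0 ≤ C')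
    (hlim : PolLimitsExist F ℰ ρ bV (Window γ)) (hS : WindowedStepRate F ℰ ρ bV γ s κ θ C')
    (h0 : ∀ g ∈ Window γ, ∀ (μ ν : Fin 4) (z : Fin 4 → ℤ), ∀ᶠ K in atTop,
      |polWindow F K 1 (ℰ 0 (histPrefix g 0) K) ρ bV μ ν z| ≤ E₀ * Real.exp (-κ * l1 z)) (μ ν : Fin 4) :
    KernelDecay F ℰ ρ bV (Window γ) μ ν κ :=
  kernelDecay_of_windowed F ℰ ρ bV hlim (windowedDecay_of_windowedStepRate_of_base F ρ bV hθ0 hθ1 hC' hS h0 μ ν)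

variable {N : ℕ} [NeZero N]

variable {ℰ} in
/-- ★ **NODE N17's (J2) SENTENCE FROM THE N18 LETTER AND THE LEVEL-0 ROW ONLY**: `PolLimitsExist … (Window θ.γ)` ((1.21) exists), W1-19b's
`WindowedStepRate … θ.γ s ℓ.κ ℓ.θ₅ (ℓ.C₅·ℓ.θ₅)` (node N18's finite-volume two-run rate), the level-0 windowed decay at rate `ℓ.κ`, the letter signs and `0 < ℓ.κ` give
`ScaleShiftRate (betaPrime510 4 (ℓ.C₅·ℓ.θ₅) ℓ.κ) ℓ.θ₅ θ.γ (betaMerged F ℰ ρ bV)` — dag-n18-w1's `kernelStepRate_of_windowed'` and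
`scaleShiftRate_betaMerged_of_kernelStepRate_of_windowedDecayUniform` with `hU :=` §3: the (UD) letter is NOT an input.
[cite: Balaban1987RG1, Thm 1 p.259, (1.18) p.263, (1.20)–(1.22) p.264 and (5.10) p.293 (mechanism; nothing of the source asserted)] -/
theorem scaleShiftRate_betaMerged_of_windowedStepRate_of_base (θ : Stage13Params F N) (ℓ : U3Letters₁₁) (hs : ℓ.Signs) (hκ : 0 < ℓ.κ)
    {s : ℕ} {E₀ : ℝ} (hlim : PolLimitsExist F ℰ ρ bV (Window θ.γ)) (hS : WindowedStepRate F ℰ ρ bV θ.γ s ℓ.κ ℓ.θ₅ (ℓ.C₅ * ℓ.θ₅))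
    (h0 : ∀ g ∈ Window θ.γ, ∀ (μ ν : Fin 4) (z : Fin 4 → ℤ), ∀ᶠ K in atTop,
      |polWindow F K 1 (ℰ 0 (histPrefix g 0) K) ρ bV μ ν z| ≤ E₀ * Real.exp (-ℓ.κ * l1 z)) :
    ScaleShiftRate (betaPrime510 4 (ℓ.C₅ * ℓ.θ₅) ℓ.κ) ℓ.θ₅ θ.γ (betaMerged F ℰ ρ bV) :=
  scaleShiftRate_betaMerged_of_kernelStepRate_of_windowedDecayUniform F ℰ ρ bV θ ℓ (kernelStepRate_of_windowed' F ρ bV s hlim hS) hκ hκ hlim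
    (windowedDecayUniform_of_windowedStepRate_of_base F ρ bV hs.θ₅_pos.le hs.θ₅_lt_one (mul_nonneg hs.C₅_nonneg hs.θ₅_pos.le) hS h0)

end FiniteVolume

/-! ## §5 At the record, Stage 13: the letters OF RECORD (the merged term family of record in the record's β-chart) -/

section Record

open scoped Matrix.Norms.L2Operator

variable (F : T4Family) (N : ℕ) [NeZero N]

/-- **W1-19c's LETTER OF RECORD FROM node N18's FINITE-VOLUME LETTER OF RECORD + THE LEVEL-0 ROW**: `WindowedStepRateOfRecord₁₃ F N θ s κ θ₅ C′`, `0 ≤ C′`,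
`0 ≤ θ₅ < 1` and the level-0 windowed decay of the merged term of record give `WindowedDecayUniformOfRecord₁₃ F N θ (E₀ + C′∕(1−θ₅)) κ`.
[cite: Balaban1987RG1, Thm 1 p.259, (1.6) p.261, (1.20) p.264 and (5.10) p.293 (mechanism; nothing of the record asserted)] -/
theorem windowedDecayUniformOfRecord₁₃_of_windowedStepRateOfRecord₁₃_of_base (θ : Stage13Params F N) {κ θ₅ C' E₀ : ℝ} {s : ℕ}
    (hθ0 : 0 ≤ θ₅) (hθ1 : θ₅ < 1) (hC' : 0 ≤ C') (hS : WindowedStepRateOfRecord₁₃ F N θ s κ θ₅ C')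
    (h0 : letI := θ.instVβ₁; letI := θ.instVβ₂; letI := θ.instιβ
      ∀ g ∈ Window θ.γ, ∀ (μ ν : Fin 4) (z : Fin 4 → ℤ), ∀ᶠ K in atTop,
        |polWindow F K 1 (mergedTermFamilyMatT F N (TβOfRecord₁₃ F N) (chiβOfRecord₁₃ F N θ) θ.εbg 0 (histPrefix g 0) K) θ.ρ8 θ.bV μ ν z| ≤
          E₀ * Real.exp (-κ * l1 z)) :
    WindowedDecayUniformOfRecord₁₃ F N θ (E₀ + C' / (1 - θ₅)) κ := by
  letI := θ.instVβ₁; letI := θ.instVβ₂; letI := θ.instιβ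
  exact windowedDecayUniform_of_windowedStepRate_of_base F θ.ρ8 θ.bV hθ0 hθ1 hC' hS h0

/-- ★ **THE v5 BILL's `hW`-CONSEQUENCE FROM ITS ROWS `hL` + `hS` + THE LEVEL-0 ROW**: `PolLimitsExistOfRecord₁₃ F N θ`, `WindowedStepRateOfRecord₁₃ F N θ s κ θ₅ C′`
(`0 ≤ C′`, `0 ≤ θ₅ < 1`) and the level-0 windowed decay of record give `KernelDecayOfRecord₁₃ F N θ μ ν κ` in EVERY direction pair — at `(0, 1)` this is
dag-n27-w1's `hdec` of the (D4) read-out, which the bill obtains from `hW` (dag-n22-w3's `kernelDecayOfRecord₁₃_of_windowed`).  The bill is NOT edited.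
[cite: Balaban1987RG1, (1.21) p.264 and (5.10) p.293 (mechanism; nothing of the record asserted)] -/
theorem kernelDecayOfRecord₁₃_of_windowedStepRateOfRecord₁₃_of_base (θ : Stage13Params F N) {κ θ₅ C' E₀ : ℝ} {s : ℕ}
    (hθ0 : 0 ≤ θ₅) (hθ1 : θ₅ < 1) (hC' : 0 ≤ C') (hL : PolLimitsExistOfRecord₁₃ F N θ) (hS : WindowedStepRateOfRecord₁₃ F N θ s κ θ₅ C')
    (h0 : letI := θ.instVβ₁; letI := θ.instVβ₂; letI := θ.instιβ
      ∀ g ∈ Window θ.γ, ∀ (μ ν : Fin 4) (z : Fin 4 → ℤ), ∀ᶠ K in atTop,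
        |polWindow F K 1 (mergedTermFamilyMatT F N (TβOfRecord₁₃ F N) (chiβOfRecord₁₃ F N θ) θ.εbg 0 (histPrefix g 0) K) θ.ρ8 θ.bV μ ν z| ≤
          E₀ * Real.exp (-κ * l1 z)) (μ ν : Fin 4) :
    KernelDecayOfRecord₁₃ F N θ μ ν κ := by
  letI := θ.instVβ₁; letI := θ.instVβ₂; letI := θ.instιβ
  exact kernelDecay_of_windowedStepRate_of_base F θ.ρ8 θ.bV hθ0 hθ1 hC' hL hS h0 μ ν

/-- **THE SAME KEYED ON A LETTER BLOCK `ℓ` UNDER ITS SIGNS** (the bill's shapes: `hS` at `(ℓ.κ, ℓ.θ₅, ℓ.C₅·ℓ.θ₅)`, conclusion at rate `ℓ.κ`; `0 ≤ ℓ.C₅·ℓ.θ₅` and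
`0 ≤ ℓ.θ₅ < 1` are `ℓ.Signs`). [cite: Balaban1987RG1, (1.21) p.264 and (5.10) p.293 (mechanism; nothing of the record asserted)] -/
theorem kernelDecayOfRecord₁₃_of_letters_of_base (θ : Stage13Params F N) (ℓ : U3Letters₁₁) (hs : ℓ.Signs) {s : ℕ} {E₀ : ℝ}
    (hL : PolLimitsExistOfRecord₁₃ F N θ) (hS : WindowedStepRateOfRecord₁₃ F N θ s ℓ.κ ℓ.θ₅ (ℓ.C₅ * ℓ.θ₅))
    (h0 : letI := θ.instVβ₁; letI := θ.instVβ₂; letI := θ.instιβ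
      ∀ g ∈ Window θ.γ, ∀ (μ ν : Fin 4) (z : Fin 4 → ℤ), ∀ᶠ K in atTop,
        |polWindow F K 1 (mergedTermFamilyMatT F N (TβOfRecord₁₃ F N) (chiβOfRecord₁₃ F N θ) θ.εbg 0 (histPrefix g 0) K) θ.ρ8 θ.bV μ ν z| ≤
          E₀ * Real.exp (-ℓ.κ * l1 z)) (μ ν : Fin 4) :
    KernelDecayOfRecord₁₃ F N θ μ ν ℓ.κ :=
  kernelDecayOfRecord₁₃_of_windowedStepRateOfRecord₁₃_of_base F N θ hs.θ₅_pos.le hs.θ₅_lt_one (mul_nonneg hs.C₅_nonneg hs.θ₅_pos.le) hL hS h0 μ ν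

/-- **LIMITING-KERNEL FORM AT THE RECORD**: node N18's letter of record `KernelStepRateOfRecord₁₃ F N θ κ θ₅ C₅` (`0 ≤ C₅`, `0 ≤ θ₅ < 1`) and the level-0 (5.10)
class of the LIMITING kernels of the merged term of record give `KernelDecayOfRecord₁₃ F N θ μ ν κ` in every direction pair — no (1.21)-existence letter needed.
[cite: Balaban1987RG1, Thm 1 p.259 and (5.10) p.293 (mechanism; nothing of the record asserted)] -/
theorem kernelDecayOfRecord₁₃_of_kernelStepRateOfRecord₁₃_of_base (θ : Stage13Params F N) {κ θ₅ C₅ E₀ : ℝ}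
    (hθ0 : 0 ≤ θ₅) (hθ1 : θ₅ < 1) (hC₅ : 0 ≤ C₅) (h18 : KernelStepRateOfRecord₁₃ F N θ κ θ₅ C₅)
    (h0 : letI := θ.instVβ₁; letI := θ.instVβ₂; letI := θ.instιβ
      ∀ g ∈ Window θ.γ, ∀ (μ ν : Fin 4),
        Decay510 (kernelA F (mergedTermFamilyMatT F N (TβOfRecord₁₃ F N) (chiβOfRecord₁₃ F N θ) θ.εbg) θ.ρ8 θ.bV g 0 μ ν) E₀ κ) (μ ν : Fin 4) :
    KernelDecayOfRecord₁₃ F N θ μ ν κ := by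
  letI := θ.instVβ₁; letI := θ.instVβ₂; letI := θ.instιβ
  exact kernelDecay_of_kernelStepRate_of_base F θ.ρ8 θ.bV hθ0 hθ1 hC₅ h18 h0 μ ν

/-- ★ **NODE N17's SENTENCE OF RECORD FROM `hL` + `hS` + THE LEVEL-0 ROW** (dag-n18-w1's `scaleShiftRate_betaMergedOfRecord_of_finiteVolumeLetters` with its `hU`
PRODUCED by §5, `δ := ℓ.κ`): `PolLimitsExistOfRecord₁₃ F N θ`, `WindowedStepRateOfRecord₁₃ F N θ s ℓ.κ ℓ.θ₅ (ℓ.C₅·ℓ.θ₅)`, the level-0 windowed decay of record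
at rate `ℓ.κ`, `ℓ.Signs` and `0 < ℓ.κ` give `ScaleShiftRate (betaPrime510 4 (ℓ.C₅·ℓ.θ₅) ℓ.κ) ℓ.θ₅ θ.γ (betaMerged F ℰ_rec θ.ρ8 θ.bV)`.
[cite: Balaban1987RG1, Thm 1 p.259, (1.6) p.261, (1.20)–(1.22) p.264 and (5.10) p.293 (mechanism; nothing of the record asserted)] -/
theorem scaleShiftRate_betaMergedOfRecord_of_windowedStepRateOfRecord₁₃_of_base (θ : Stage13Params F N) (ℓ : U3Letters₁₁) (hs : ℓ.Signs) (hκ : 0 < ℓ.κ)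
    {s : ℕ} {E₀ : ℝ} (hL : PolLimitsExistOfRecord₁₃ F N θ) (hS : WindowedStepRateOfRecord₁₃ F N θ s ℓ.κ ℓ.θ₅ (ℓ.C₅ * ℓ.θ₅))
    (h0 : letI := θ.instVβ₁; letI := θ.instVβ₂; letI := θ.instιβ
      ∀ g ∈ Window θ.γ, ∀ (μ ν : Fin 4) (z : Fin 4 → ℤ), ∀ᶠ K in atTop,
        |polWindow F K 1 (mergedTermFamilyMatT F N (TβOfRecord₁₃ F N) (chiβOfRecord₁₃ F N θ) θ.εbg 0 (histPrefix g 0) K) θ.ρ8 θ.bV μ ν z| ≤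
          E₀ * Real.exp (-ℓ.κ * l1 z)) :
    letI := θ.instVβ₁; letI := θ.instVβ₂; letI := θ.instιβ
    ScaleShiftRate (betaPrime510 4 (ℓ.C₅ * ℓ.θ₅) ℓ.κ) ℓ.θ₅ θ.γ
      (betaMerged F (mergedTermFamilyMatT F N (TβOfRecord₁₃ F N) (chiβOfRecord₁₃ F N θ) θ.εbg) θ.ρ8 θ.bV) :=
  scaleShiftRate_betaMergedOfRecord_of_uniformLetter F N θ ℓ (kernelStepRateOfRecord₁₃_of_windowed' F N θ s hL hS) hκ hκ hL
    (windowedDecayUniformOfRecord₁₃_of_windowedStepRateOfRecord₁₃_of_base F N θ hs.θ₅_pos.le hs.θ₅_lt_one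
      (mul_nonneg hs.C₅_nonneg hs.θ₅_pos.le) hS h0)

end Record

end YMDAG.N18.UniformDecayOfStepRate

end
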